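import Literature.AnabelianGeometry.SemiGraphs.ChartFibreFunctorFin
import Literature.AnabelianGeometry.Anabelioids.AutOfEquivalence
import Literature.AnabelianGeometry.Anabelioids.BCatBranchConjugacy
import HarnessLib

/-!
# [SemiAnbd] Prop. 3.6 (iv)/(iii): the induced homomorphism of tempered fundamental groups is
# compatible with the induced homomorphism of profinite fundamental groups (B7c (iii), group form)

Mochizuki, *Semi-graphs of anabelioids*, Publ. RIMS **42** (2006), Prop. 3.6 (iv) p. 39 (a morphism
`F : 𝒢 → ℋ` induces `π₁^temp(𝒢) → π₁^temp(ℋ)` by pulling back tempered coverings) and Prop. 3.6 (iii)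
p. 38 (`π₁^temp(−) → π̂₁(B(−))`) [cite: MochizukiSemiAnbd2006, Prop 3.6(iv) p.39].  Sequel to
`ChartFibreFunctor(Fin).lean` (abc-iut L3, bridge B7c (iii) in the form asked for by the consumers of
the Π-bridge): for charts `c_𝒢`, `c_ℋ`, a continuous `φ : π₁^temp(𝒢) → π₁^temp(ℋ)` with
`i : F.chartPullback c_𝒢 c_ℋ ≅ B^temp(φ)` (the body of `Hom.Induces`),

* `Hom.chartFibreFinPullbackIso i : chartFibreFin c_ℋ ≅ F.toAnab^* ⋙ chartFibreFin c_𝒢` — the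
  canonical transport of chart basepoints with finite values;
* `Hom.piHatMap i : Aut (chartFibreFin c_𝒢) →* Aut (chartFibreFin c_ℋ)` — the homomorphism
  `φ̂ : π̂₁(B(𝒢)) → π̂₁(B(ℋ))` induced by `F.toAnab` at the chart basepoints (whisker with `F.toAnab^*`,
  conjugate by the transport), with `Hom.continuous_piHatMap`;
* `Hom.piHatMap_chartActionFin : φ̂ (ι_𝒢 g) = ι_ℋ (φ g)` — **`φ̂ ∘ ι_𝒢 = ι_ℋ ∘ φ` on the nose**, where
  `ι = chartActionFin : π₁^temp(−) → π̂₁(B(−))` is the homomorphism of Prop. 3.6 (iii).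

Nothing here takes a side on [IUTchIII] Cor. 3.12.
-/

noncomputable section

namespace Literature.AnabelianGeometry.SemiGraphs

open CategoryTheory CategoryTheory.Limits CategoryTheory.PreGaloisCategory
open Literature.AnabelianGeometry.Anabelioids
open Literature.AlgebraicGeometry.Frobenioids (BCat)
open scoped FintypeCatDiscrete Pointwise

universe u

namespace ProfiniteSemiGraph

namespace Hom

variable {𝒢 ℋ : ProfiniteSemiGraph.{u}} (F : Hom 𝒢 ℋ)
  {c𝒢 : TemperedPiChart 𝒢} {cℋ : TemperedPiChart ℋ} {φ : c𝒢.G →ₜ* cℋ.G}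
  (h𝒢 : ∀ S : CovObj 𝒢, S.IsFinite → S.IsTempered) (hℋ : ∀ S : CovObj ℋ, S.IsFinite → S.IsTempered)
  (hfin𝒢 : ∀ X : 𝒢.toAnab.BObj, Finite ((chartFibre c𝒢 h𝒢).obj X))
  (hfinℋ : ∀ X : ℋ.toAnab.BObj, Finite ((chartFibre cℋ hℋ).obj X))

/-- **The canonical transport of chart basepoints with finite values** along `F` and an induced `φ`:
`chartFibreFin c_ℋ ≅ F.toAnab^* ⋙ chartFibreFin c_𝒢` (the isomorphism `chartFibrePullbackIso` of
underlying sets, descended along the fully faithful `FintypeCat.incl`).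
[cite: MochizukiSemiAnbd2006, Prop 3.6(iv) p.39] -/
def chartFibreFinPullbackIso (i : F.chartPullback c𝒢 cℋ ≅ BTemp.res φ) :
    chartFibreFin cℋ hℋ hfinℋ ≅ F.toAnab.pullbackFunctor ⋙ chartFibreFin c𝒢 h𝒢 hfin𝒢 :=
  ((ObjectProperty.fullyFaithfulι (fun X : Type u => Finite X)).whiskeringRight _).preimageIso
    (F.chartFibrePullbackIso h𝒢 hℋ i)

/-- On elements the finite-valued transport is `chartFibrePullbackIso`.
[cite: MochizukiSemiAnbd2006, Prop 3.6(iv) p.39] -/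
theorem chartFibreFinPullbackIso_hom_app_apply (i : F.chartPullback c𝒢 cℋ ≅ BTemp.res φ)
    (X : ℋ.toAnab.BObj) (y : (chartFibreFin cℋ hℋ hfinℋ).obj X) :
    (F.chartFibreFinPullbackIso h𝒢 hℋ hfin𝒢 hfinℋ i).hom.app X y =
      (F.chartFibrePullbackIso h𝒢 hℋ i).hom.app X y := rfl

/-- **`φ̂ : π̂₁(B(𝒢)) → π̂₁(B(ℋ))` at the chart basepoints** — the homomorphism of profinite fundamental
groups induced by the morphism of anabelioids `B(𝒢) → B(ℋ)` of `F.toAnab` ([SemiAnbd] Rmk. 2.11.1 /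
[GeoAn] Def. 1.1.2 (ii): whisker an automorphism of the basepoint with the pull-back functor), read at
the chart basepoint of `ℋ` through the canonical transport.
[cite: MochizukiSemiAnbd2006, Prop 3.6(iv) p.39] -/
def piHatMap (i : F.chartPullback c𝒢 cℋ ≅ BTemp.res φ) :
    Aut (chartFibreFin c𝒢 h𝒢 hfin𝒢) →* Aut (chartFibreFin cℋ hℋ hfinℋ) :=
  (F.chartFibreFinPullbackIso h𝒢 hℋ hfin𝒢 hfinℋ i).symm.conjAut.toMonoidHom.comp
    (pi1Map F.toAnab.pullbackFunctor (chartFibreFin c𝒢 h𝒢 hfin𝒢))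

/-- `φ̂` on elements: `(φ̂ σ)_X (y) = J⁻¹ (σ_{F.toAnab^* X} (J y))`.
[cite: MochizukiSemiAnbd2006, Prop 3.6(iv) p.39] -/
theorem piHatMap_hom_app_apply (i : F.chartPullback c𝒢 cℋ ≅ BTemp.res φ)
    (σ : Aut (chartFibreFin c𝒢 h𝒢 hfin𝒢)) (X : ℋ.toAnab.BObj) (y : (chartFibreFin cℋ hℋ hfinℋ).obj X) :
    (F.piHatMap h𝒢 hℋ hfin𝒢 hfinℋ i σ).hom.app X y =
      (F.chartFibreFinPullbackIso h𝒢 hℋ hfin𝒢 hfinℋ i).inv.app X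
        (σ.hom.app (F.toAnab.pullbackFunctor.obj X)
          ((F.chartFibreFinPullbackIso h𝒢 hℋ hfin𝒢 hfinℋ i).hom.app X y)) := by
  change ((F.chartFibreFinPullbackIso h𝒢 hℋ hfin𝒢 hfinℋ i).symm.conjAut
    (pi1Map F.toAnab.pullbackFunctor (chartFibreFin c𝒢 h𝒢 hfin𝒢) σ)).hom.app X y = _
  rw [Iso.conjAut_hom, Iso.conj_apply]
  rfl

/-- **`φ̂` is continuous** (whiskering and conjugation by an isomorphism of fibre functors are
continuous for the profinite topologies). [cite: MochizukiSemiAnbd2006, Prop 3.6(iv) p.39] -/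
theorem continuous_piHatMap (hconn : ℋ.graph.IsConnected) (i : F.chartPullback c𝒢 cℋ ≅ BTemp.res φ)
    (hΦ : letI := ℋ.toAnab.preGaloisCategory_bObj; FiberFunctor (chartFibreFin cℋ hℋ hfinℋ)) :
    Continuous (F.piHatMap h𝒢 hℋ hfin𝒢 hfinℋ i) := by
  letI := ℋ.toAnab.galoisCategory_bObj ⟨hconn⟩
  haveI := hΦ
  obtain ⟨hΦ'⟩ := nonempty_fiberFunctor_of_iso (F.chartFibreFinPullbackIso h𝒢 hℋ hfin𝒢 hfinℋ i).symm
  exact (continuous_conjAut_of_iso (F.chartFibreFinPullbackIso h𝒢 hℋ hfin𝒢 hfinℋ i).symm).comp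
    (continuous_pi1Map' F.toAnab.pullbackFunctor (chartFibreFin c𝒢 h𝒢 hfin𝒢))

/-- **B7c (iii), group form — `φ̂ ∘ ι_𝒢 = ι_ℋ ∘ φ` on the nose** ([SemiAnbd] Prop. 3.6 (iv) with (iii)):
for `g ∈ π₁^temp(𝒢)`, the automorphism of `π̂₁(B(ℋ))` induced from the chart action of `g` equals the
chart action of `φ g` — because the canonical transport is `φ`-equivariant (`chartAction_pullback`).
[cite: MochizukiSemiAnbd2006, Prop 3.6(iv) p.39] -/
theorem piHatMap_chartActionFin (i : F.chartPullback c𝒢 cℋ ≅ BTemp.res φ) (g : c𝒢.G) :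
    F.piHatMap h𝒢 hℋ hfin𝒢 hfinℋ i (chartActionFin c𝒢 h𝒢 hfin𝒢 g) = chartActionFin cℋ hℋ hfinℋ (φ g) := by
  apply Iso.ext
  apply NatTrans.ext
  funext X
  apply ConcreteCategory.hom_ext
  intro y
  rw [piHatMap_hom_app_apply]
  -- `σ_{F^* X} (J y) = J (ι_ℋ (φ g) y)` by the equivariance of the transport
  have h1 : (chartActionFin c𝒢 h𝒢 hfin𝒢 g).hom.app (F.toAnab.pullbackFunctor.obj X)
      ((F.chartFibreFinPullbackIso h𝒢 hℋ hfin𝒢 hfinℋ i).hom.app X y) =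
      (F.chartFibreFinPullbackIso h𝒢 hℋ hfin𝒢 hfinℋ i).hom.app X
        ((chartActionFin cℋ hℋ hfinℋ (φ g)).hom.app X y) :=
    (F.chartAction_pullback h𝒢 hℋ i g X y).symm
  rw [h1]
  exact Iso.hom_inv_id_app_apply (F.chartFibreFinPullbackIso h𝒢 hℋ hfin𝒢 hfinℋ i) X _

end Hom

end ProfiniteSemiGraph

end Literature.AnabelianGeometry.SemiGraphs

end
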